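import Summits.ResolutionOfSingularities.ResolutionOfSingularities.Theorems.PurelyInseparableDim4JointForestNormalised
import Summits.ResolutionOfSingularities.ResolutionOfSingularities.Theorems.PurelyInseparableDim4JointTreeRoot
import HarnessLib

/-!
# Purely inseparable four-folds: the MONOTONE JOINT FOREST from the ROOT with the COVER asked on NORMALISED chart
# representatives only — hypotheses on `F` (brick S3 (c) «joint point∘coordinate chains», part 21, cell `res-dim4-pi`)

[OURS · counted 0] (D-0157 DOOR 2; desk WORD #66 (4)(c), #74 (g), #99 (d); frame `PIDim4.TerminationImpliesOrderReduction`,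
S3 (c); host item stmt-ResolutionOfSingularities-16155, helper). Nothing here proves resolution of singularities in
dimension ≥ 4 / characteristic `p` — NOT here, not anywhere in this programme.

Part 15's `exists_isMarkedResolution_joint_forest_root`, verbatim, EXCEPT that the hereditary COVER clause is only required
for NORMALISED pairs (`b′_k = 0` for `k ∈ S`, `k < j′`), via part 20. A plan lists each child once, in its least chart.

* **`exists_isMarkedResolution_joint_forest_root_normalised`** — `K = K̄` of characteristic `p`, `F ≠ 0` clean; members,
  plan, leaves, `Acc`, separated members, finite off-member roots with point walks ⇒ `(𝔸⁵_K, (z^p + F)·𝒪, [], p)` admits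
  a marked resolution (BGMW Def. 3.1.3).

HONEST SCOPE as parts 14/20. AI-produced formalisation, weaker than expert review.
bears_on: LADDER-RESOLUTION:D157-DOOR2 (res-dim4-pi · S3 (c) joint v2 · root, normalised cover).
-/

set_option linter.dupNamespace false -- D-0017: single-problem summit path `Summit.<S>.<S>.…` by design

noncomputable section

open MvPolynomial Finset CategoryTheory AlgebraicGeometry Opposite TopologicalSpace
open AlgebraicGeometry.Scheme.IdealSheafData (ofIdealTop vanishingIdeal)

namespace Summit.ResolutionOfSingularities.ResolutionOfSingularities.Theorems.PIDim4

open Literature.AlgebraicGeometry.Resolution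
open Literature.AlgebraicGeometry.Resolution.Hauser2010
open Literature.AlgebraicGeometry.Resolution.AffinePointBlowup (P A γ coord Wtop ξ)

namespace Equimultiple

section ForestRoot

variable {K : Type} [Field K] {p : ℕ} [hp : Fact p.Prime] [CharP K p]

/-- **THE MONOTONE JOINT FOREST FROM THE ROOT, NORMALISED COVER (hypotheses on `F` only).** See the module docstring.
[cite: BierstoneGrigorievMilmanWlodarczyk2011, Def. 3.1.3; §4 Step 2b] [cite: Hauser2010, §§F–G]
[cite: HauserPerlega2019PRIMS, §2 (permissible centres P = (z, x_i : i ∈ Γ))]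
[cite: Hironaka1964, Main Theorem I (the characteristic-zero statement whose analogue is asked)] -/
theorem exists_isMarkedResolution_joint_forest_root_normalised [IsAlgClosed K] [DecidableEq K] (F : MvPolynomial (Fin 4) K)
    (hF : F ≠ 0) (hclean : Literature.Barriers.ResolutionOfSingularities.HauserPerlega.IsClean p F)
    (plan : State K → Finset (Fin 4) → Finset (Fin 4 × (Fin 4 → K) × Finset (Fin 4)))
    (leaves : State K → Finset (Fin 4) → Finset (Fin 4 × (Fin 4 → K)))
    (mem : Finset ((Fin 4 → K) × Finset (Fin 4)))
    (hmem : ∀ bS ∈ mem, IsPermissibleCentre p bS.2 (deletePthPowers p (PointBlowup.translate bS.1 F)) ∧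
      (∀ q : State K × Finset (Fin 4),
        Relation.ReflTransGen (fun q q' : State K × Finset (Fin 4) =>
          ∃ e ∈ plan q.1 q.2, q' = (CentreBlowup.step p q.2 e.1 e.2.1 q.1, e.2.2))
          ((⟨deletePthPowers p (PointBlowup.translate bS.1 F), 0, ∅⟩ : State K), bS.2) q →
        (∀ e ∈ plan q.1 q.2, e.1 ∈ q.2 ∧ e.2.1 e.1 = 0 ∧ q.2 ⊆ e.2.2 ∧
            CentreBlowup.IsEquimultiplePoint p q.2 e.1 e.2.1 q.1 ∧
            IsPermissibleCentre p e.2.2 (CentreBlowup.step p q.2 e.1 e.2.1 q.1).F) ∧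
        (∀ e ∈ plan q.1 q.2, ∀ e' ∈ plan q.1 q.2, e ≠ e' →
            (e.1 = e'.1 ∧ ∃ i ∈ e.2.2, i ∈ e'.2.2 ∧ e.2.1 i ≠ e'.2.1 i) ∨
            (e.1 ≠ e'.1 ∧ ((e'.2.1 e.1 = 0 ∧ e.1 ∈ e'.2.2) ∨ (e.2.1 e'.1 = 0 ∧ e'.1 ∈ e.2.2)))) ∧
        (∀ l ∈ leaves q.1 q.2, CentreBlowup.IsEquimultiplePoint p q.2 l.1 l.2 q.1 →
            Acc (fun s' s : State K => Edge p Finset.univ s s') (CentreBlowup.step p q.2 l.1 l.2 q.1) ∧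
            ∀ s' : State K, Relation.ReflTransGen (fun a e : State K => Edge p Finset.univ a e)
                (CentreBlowup.step p q.2 l.1 l.2 q.1) s' →
              {jb : Fin 4 × (Fin 4 → K) | jb.2 jb.1 = 0 ∧
                CentreBlowup.IsEquimultiplePoint p Finset.univ jb.1 jb.2 s'}.Finite) ∧
        (∀ (j' : Fin 4) (b' : Fin 4 → K), j' ∈ q.2 → b' j' = 0 → (∀ k ∈ q.2, k < j' → b' k = 0) →
            CentreBlowup.IsEquimultiplePoint p q.2 j' b' q.1 →
            (∃ e ∈ plan q.1 q.2, e.1 = j' ∧ ∀ i ∈ e.2.2, b' i = e.2.1 i) ∨ (j', b') ∈ leaves q.1 q.2)) ∧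
      Acc (fun q' q : State K × Finset (Fin 4) =>
          ∃ e ∈ plan q.1 q.2, q' = (CentreBlowup.step p q.2 e.1 e.2.1 q.1, e.2.2))
        ((⟨deletePthPowers p (PointBlowup.translate bS.1 F), 0, ∅⟩ : State K), bS.2))
    (hsep : ∀ bS ∈ mem, ∀ bS' ∈ mem, bS ≠ bS' → ∃ i ∈ bS.2, i ∈ bS'.2 ∧ bS.1 i ≠ bS'.1 i)
    (hroots : {b' : Fin 4 → K | (∀ d : Fin 4 →₀ ℕ, d ≠ 0 → d.degree < p →
        coeff d (PointBlowup.translate b' F) = 0) ∧ ∀ bS ∈ mem, ¬ ∀ i ∈ bS.2, b' i = bS.1 i}.Finite)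
    (hwalk₀ : ∀ b' : Fin 4 → K, (∀ d : Fin 4 →₀ ℕ, d ≠ 0 → d.degree < p → coeff d (PointBlowup.translate b' F) = 0) →
      (∀ bS ∈ mem, ¬ ∀ i ∈ bS.2, b' i = bS.1 i) →
      Acc (fun s' s : State K => Edge p Finset.univ s s')
          (⟨deletePthPowers p (PointBlowup.translate b' F), 0, ∅⟩ : State K) ∧
        ∀ s' : State K, Relation.ReflTransGen (fun a e : State K => Edge p Finset.univ a e)
            (⟨deletePthPowers p (PointBlowup.translate b' F), 0, ∅⟩ : State K) s' →
          {jb : Fin 4 × (Fin 4 → K) | jb.2 jb.1 = 0 ∧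
            CentreBlowup.IsEquimultiplePoint p Finset.univ jb.1 jb.2 s'}.Finite) :
    ∃ (X' : Scheme.{0}) (ρ : X' ⟶ P 4 K) (M' : MarkedIdeal X'),
      IsMarkedResolution (⟨hypSheaf p F, [], p⟩ : MarkedIdeal (P 4 K)) ρ M' := by
  classical
  haveI : PerfectRing K p := PerfectRing.ofSurjective K p fun x => IsAlgClosed.exists_pow_nat_eq x hp.out.pos
  set M₀ : MarkedIdeal (P 4 K) := ⟨hypSheaf p F, [], p⟩ with hM₀
  have hE₀ : HasSNC M₀.boundary :=
    hasSNC_nil_of_isRegular (Literature.AlgebraicGeometry.Hironaka2017.Lib.AffinePointBlowupLSB.isRegular_Z 4 K)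
  -- the coordinate members
  let cof : (Fin 4 → K) × Finset (Fin 4) → Closeds (P 4 K) := fun bS =>
    if h : bS ∈ mem then (root_member_package (p := p) F bS.1 (hmem bS h).1).choose else ⊥
  have hcof : ∀ bS (h : bS ∈ mem), cof bS = (root_member_package (p := p) F bS.1 (hmem bS h).1).choose :=
    fun bS h => dif_pos h
  set cms : Finset (Closeds (P 4 K)) := mem.image cof with hcms
  let rep : Closeds (P 4 K) → (Fin 4 → K) × Finset (Fin 4) := fun c =>
    if h : ∃ bS ∈ mem, cof bS = c then h.choose else ((0 : Fin 4 → K), (∅ : Finset (Fin 4)))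
  have hrep : ∀ c ∈ cms, rep c ∈ mem ∧ cof (rep c) = c := by
    intro c hc
    have h : ∃ bS ∈ mem, cof bS = c := by simpa [hcms, Finset.mem_image] using hc
    have hr : rep c = h.choose := dif_pos h
    rw [hr]
    exact h.choose_spec
  set cst : Closeds (P 4 K) → State K := fun c => ⟨deletePthPowers p (PointBlowup.translate (rep c).1 F), 0, ∅⟩
    with hcst
  set ctr : Closeds (P 4 K) → Finset (Fin 4) := fun c => (rep c).2 with hctr
  -- coordinate description of the members
  have hin : ∀ c ∈ cms, ∀ z : P 4 K, z ∈ (c : Set (P 4 K)) → ∀ i ∈ (rep c).2, (X i.succ - C ((rep c).1 i) : A 4 K) ∈ z.asIdeal := by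
    intro c hc z hz
    obtain ⟨hr, hcr⟩ := hrep c hc
    have hspec := (root_member_package (p := p) F (rep c).1 (hmem _ hr).1).choose_spec
    rw [← hcof _ hr, hcr] at hspec
    exact hspec.2.2.2.1 z hz
  have hon : ∀ bS ∈ mem, ∀ z : P 4 K, IsClosed ({z} : Set (P 4 K)) → (1 : ℕ∞) ≤ idealOrder (hypSheaf p F) z →
      (∀ i ∈ bS.2, (X i.succ - C (bS.1 i) : A 4 K) ∈ z.asIdeal) → z ∈ (cof bS : Set (P 4 K)) := by
    intro bS h z hzc hord hzS
    rw [hcof bS h]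
    exact (root_member_package (p := p) F bS.1 (hmem bS h).1).choose_spec.2.2.2.2 z hzc hord hzS
  -- the point members: closed order-`p` points off every member
  have hfin₀ : {z : P 4 K | IsClosed ({z} : Set (P 4 K)) ∧ (p : ℕ∞) ≤ idealOrder (hypSheaf p F) z ∧
      ∀ c ∈ cms, z ∉ (c : Set (P 4 K))}.Finite := by
    let pt : (Fin (4 + 1) → K) → P 4 K := fun v => ⟨MvPolynomial.vanishingIdeal K {v}, inferInstance⟩
    let g : (Fin 4 → K) → P 4 K := fun b => pt (Fin.cons ((frobeniusEquiv K p).symm (-MvPolynomial.eval b F)) b)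
    refine (hroots.image g).subset fun z hz => ?_
    obtain ⟨hzc, hord, hzoff⟩ := hz
    obtain ⟨a', b', hzab⟩ := exists_eq_vanishingIdeal_cons_of_isClosed hzc
    have hord' := (natCast_le_idealOrder_hypSheaf_iff (p := p) F hzab p).mp hord
    rw [natCast_le_ordZero_translate_hyp_iff] at hord'
    obtain ⟨hab, H⟩ := hord'
    have ha : (frobeniusEquiv K p).symm (-MvPolynomial.eval b' F) = a' := by
      apply (frobeniusEquiv K p).injective
      rw [RingEquiv.apply_symm_apply, frobeniusEquiv_def]
      exact (eq_neg_of_add_eq_zero_left hab).symm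
    refine ⟨b', ⟨H, fun bS hbS hall => hzoff (cof bS) (Finset.mem_image_of_mem cof hbS) ?_⟩, ?_⟩
    · exact hon bS hbS z hzc (le_trans (by exact_mod_cast hp.out.one_lt.le) hord)
        fun i hi => (X_succ_sub_C_mem_asIdeal_iff i _ a' b' hzab).mpr (hall i hi)
    · apply PrimeSpectrum.ext
      change MvPolynomial.vanishingIdeal K {(Fin.cons ((frobeniusEquiv K p).symm (-MvPolynomial.eval b' F)) b' :
        Fin (4 + 1) → K)} = z.asIdeal
      rw [ha, hzab]
  set pts : Finset (P 4 K) := hfin₀.toFinset with hpts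
  have hmem_pts : ∀ z : P 4 K, z ∈ pts ↔ IsClosed ({z} : Set (P 4 K)) ∧ (p : ℕ∞) ≤ idealOrder (hypSheaf p F) z ∧
      ∀ c ∈ cms, z ∉ (c : Set (P 4 K)) := fun z => by rw [hpts, Set.Finite.mem_toFinset, Set.mem_setOf_eq]
  set st : P 4 K → State K := fun z =>
    if hz : IsClosed ({z} : Set (P 4 K)) then
      ⟨deletePthPowers p (PointBlowup.translate (exists_eq_vanishingIdeal_cons_of_isClosed hz).choose_spec.choose F),
        0, ∅⟩
    else ⟨F, 0, ∅⟩ with hst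
  -- the multiset of the initial members is accessible for the cut-expansion of the child relation
  haveI : Std.Irrefl (fun q' q : State K × Finset (Fin 4) =>
      (∃ e ∈ plan q.1 q.2, q' = (CentreBlowup.step p q.2 e.1 e.2.1 q.1, e.2.2)) ∧ q' ≠ q) := ⟨fun q hq => hq.2 rfl⟩
  have hT : Acc (Relation.CutExpand (fun q' q : State K × Finset (Fin 4) =>
      (∃ e ∈ plan q.1 q.2, q' = (CentreBlowup.step p q.2 e.1 e.2.1 q.1, e.2.2)) ∧ q' ≠ q))
      (cms.val.map fun c => (cst c, ctr c)) := by
    refine Relation.acc_of_singleton fun q hq => ?_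
    rw [Multiset.mem_map] at hq
    obtain ⟨c, hc, rfl⟩ := hq
    obtain ⟨hr, -⟩ := hrep c (Finset.mem_val.mp hc)
    exact (Subrelation.accessible (fun hs => hs.1) (hmem _ hr).2.2).cutExpand
  refine exists_isMarkedResolution_of_joint_forest_normalised M₀ hE₀ rfl plan leaves _ hT (P 4 K) (𝟙 _) M₀
    (IsMultipleBlowup.refl M₀) pts st (fun z hz => ((hmem_pts z).mp hz).1) (fun z hz => ?_) cms cst ctr rfl
    (fun c hc => ?_) (fun c hc c' hc' hcc => ?_) (fun z hz c hc => ((hmem_pts z).mp hz).2.2 c hc)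
    (fun z hz hzo => ?_)
  · -- data of the point members (typ-3 g2's root charts)
    obtain ⟨hzc, hord, hzoff⟩ := (hmem_pts z).mp hz
    set a := (exists_eq_vanishingIdeal_cons_of_isClosed hzc).choose with ha
    set b := (exists_eq_vanishingIdeal_cons_of_isClosed hzc).choose_spec.choose with hb
    have hzab : z.asIdeal = MvPolynomial.vanishingIdeal K {(Fin.cons a b : Fin (4 + 1) → K)} :=
      (exists_eq_vanishingIdeal_cons_of_isClosed hzc).choose_spec.choose_spec
    have hstz : st z = ⟨deletePthPowers p (PointBlowup.translate b F), 0, ∅⟩ := by rw [hst]; exact dif_pos hzc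
    have hord' := (natCast_le_idealOrder_hypSheaf_iff (p := p) F hzab p).mp hord
    rw [natCast_le_ordZero_translate_hyp_iff] at hord'
    obtain ⟨hab, H⟩ := hord'
    have hoff : ∀ bS ∈ mem, ¬ ∀ i ∈ bS.2, b i = bS.1 i := fun bS hbS hall =>
      hzoff (cof bS) (Finset.mem_image_of_mem cof hbS) (hon bS hbS z hzc
        (le_trans (by exact_mod_cast hp.out.one_lt.le) hord)
        fun i hi => (X_succ_sub_C_mem_asIdeal_iff i _ a b hzab).mpr (hall i hi))
    obtain ⟨φ, _, hφ, hMφ⟩ := exists_chart_recenter (p := p) F a b hab hzab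
    obtain ⟨hacc, hloc⟩ := hwalk₀ b H hoff
    rw [hstz]
    refine ⟨deletePthPowers_translate_ne_zero hF hclean b, isClean_deletePthPowers _,
      ordAlong_univ_deletePthPowers_translate F b H, hacc, fun s' hs' => ?_, P 4 K, φ, 𝟙 _, inferInstance,
      inferInstance, ξ 4 K, hφ, rfl, by rw [Scheme.IdealSheafData.comap_id]; exact hMφ⟩
    exact finite_closedOver_model_of_finite_pairs s'
      (ordAlong_univ_of_reflTransGen_edge (ordAlong_univ_deletePthPowers_translate F b H) hs') (hloc s' hs')
  · -- data of the coordinate members (empty boundary: the shape datum is vacuous)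
    obtain ⟨hr, hcr⟩ := hrep c hc
    obtain ⟨hS, hplan, hacc⟩ := hmem _ hr
    have hspec := (root_member_package (p := p) F (rep c).1 hS).choose_spec
    rw [← hcof _ hr, hcr] at hspec
    obtain ⟨hreg, hsnc, ⟨Y, φ, ψ, _, _, hM, hZ, hcφ, hsee⟩, -, -⟩ := hspec
    exact ⟨deletePthPowers_translate_ne_zero hF hclean _, isClean_deletePthPowers _, hS, hreg, hsnc,
      ⟨Y, φ, ψ, inferInstance, inferInstance, hM, hZ, hcφ, hsee, fun _ => 0, fun _ => 0,
        fun D hD => (List.not_mem_nil hD).elim, fun D hD => (List.not_mem_nil hD).elim⟩, hplan, hacc⟩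
  · -- the members are pairwise disjoint (separated parameters)
    obtain ⟨hr, hcr⟩ := hrep c hc
    obtain ⟨hr', hcr'⟩ := hrep c' hc'
    have hne : rep c ≠ rep c' := fun h => hcc (by rw [← hcr, ← hcr', h])
    obtain ⟨i, hi, hi', hb⟩ := hsep _ hr _ hr' hne
    rw [Set.disjoint_left]
    intro z hz hz'
    have h1 := hin c hc z hz i hi
    have h2 := hin c' hc' z hz' i hi'
    have h3 : (C ((rep c').1 i - (rep c).1 i) : A 4 K) ∈ z.asIdeal := by
      have h := z.asIdeal.sub_mem h1 h2
      rwa [sub_sub_sub_cancel_left, ← map_sub] at h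
    exact z.2.ne_top (z.asIdeal.eq_top_of_isUnit_mem h3
      ((isUnit_iff_ne_zero.mpr (sub_ne_zero.mpr (Ne.symm hb))).map C))
  · -- every closed order-`p` point is a member
    by_cases h : ∃ c ∈ cms, z ∈ (c : Set (P 4 K))
    · exact Or.inr h
    · push Not at h
      exact Or.inl ((hmem_pts z).mpr ⟨hz, hzo, h⟩)

end ForestRoot

end Equimultiple

end Summit.ResolutionOfSingularities.ResolutionOfSingularities.Theorems.PIDim4

end
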